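import Summits.AnomalousDissipation.AnomalousDissipation.Theorems.SolenoidalFractalHomogenisationLagrangianStepOneLevelSplitDefsH
import Summits.AnomalousDissipation.AnomalousDissipation.Theorems.IsotropicCubatureWord

/-!
# K1L_D (stmt-AnomalousDissipation-27980) — W7 `HighLabelDecayW`: PER-CLASS form `ClassDecayW` + admissibility predicates + splice
(definitions and sorry-free glue lemmas only; text = planner ad-ideate-p5 g9's `Cruxes/LagrangianRenormalisationStep/Lines/onelevel_highLabelDecay_recut.lean`
ll. 35–108 byte-for-byte, re-namespaced from `…Cruxes.LagrangianRenormalisationStepDesign.HighLabelDecayRecut` to the Theorems-side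
`…Theorems.SolenoidalFractalHomogenisation.LagrangianStep` (where `HighLabelDecayW` lives, DefsH p659807), so that the three W7 pieces
`stub_classReduction` / `stub_compactRange` / `stub_largeR` of registry v5 are stated over LANDED declarations and can be closed by name.
Tenure D25-4.)

* `ClassDecayW W M hM lo hi Λ β ν₀ Kb CK cK adm` — the high-label decay clause for data supported on ONE Bloch class `ℓ + nℤ³` at distance `≥ L`
  from the lattice, under an admissibility predicate `adm n ν ℓ`;
* `admAll`, `admCompact R₁` (label ratio `r = dist/(nν) ≤ R₁`), `admLarge R₁` (`r ≥ R₁`);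
* `profile_mono`, `classDecayW_mono` (monotone in `(CK, cK, ν₀, adm)`), `classDecayW_split` (near ∪ far = all, constants `max CK`, `min cK`, `min ν₀`).
-/

set_option linter.dupNamespace false

namespace Summit.AnomalousDissipation.AnomalousDissipation.Theorems.SolenoidalFractalHomogenisation.LagrangianStep

open Literature.Analysis Literature.Analysis.FluidPDE Literature.Analysis.FunctionSpaces
open MeasureTheory Set
open scoped InnerProductSpace
open Summit.AnomalousDissipation.AnomalousDissipation.Theorems

noncomputable section


/-- PER-CLASS high-label decay with an admissibility predicate `adm n ν ℓ` on the Bloch class `ℓ + nℤ³` (all classes: `admAll`;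
near classes `dist ≤ R₁ n ν`: `admCompact R₁`; far classes: `admLarge R₁`).  Same binders and conclusion as `HighLabelDecayW`, the support
hypothesis being: `F` has modes only on the CONJUGATE PAIR of classes `(ℓ + nℤ³) ∪ (−ℓ + nℤ³)` (the general real single-label datum —
`VF` is real, so `modeCoeff (−k') F = conj (modeCoeff k' F)`; review p4 g13, tenure D25-5), and the class stays at distance `≥ L` from the lattice `nℤ³`.
[cite: BedrossianCotiZelati2017, Thm 1.1 (enhanced dissipation in shear flows) — the mechanism; the clause itself is this route's hypothesis (W7 per-class form), text p5 g9] -/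
def ClassDecayW {k : ℕ} (W : LatticeShear.LatticeWord k) (M : ℝ) (hM : 0 < M) (lo hi Λ β ν₀ Kb CK cK : ℝ)
    (adm : ℕ → ℝ → (Fin 3 → ℤ) → Prop) : Prop :=
  ∀ ν, ∀ hν : ν ∈ Set.Ioo 0 ν₀, ∀ n : ℕ, 1 ≤ n → ∀ 𝔸 : Torus.Visc4 (Fin 3),
    Torus.OddSmall 𝔸 (ν * β) → (∃ lam ∈ Set.Icc (1:ℝ) Λ, Torus.NearIso 𝔸 (ν * (lo / lam)) (ν * (hi * lam))) →
    ∀ L > (0:ℝ), (n : ℝ) * ν ≤ Kb * L →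
    ∀ ℓ : Fin 3 → ℤ, (∀ z : Fin 3 → ℤ, L ≤ ‖Torus.latticeVec (ℓ + (n : ℤ) • z)‖) → adm n ν ℓ →
    ∀ F : VF, IsDatum F →
      (∀ k' : Fin 3 → ℤ, (¬ ∃ z : Fin 3 → ℤ, k' = ℓ + (n : ℤ) • z) → (¬ ∃ z : Fin 3 → ℤ, k' = -ℓ + (n : ℤ) • z) →
        ∀ i, modeCoeff k' F i = 0) →
      ∀ T > (0:ℝ), ∀ u : ℝ → VF,
        Torus.IsWeakTensorPassiveVectorOn 0 T ((1 / (n:ℝ) ^ 2) • 𝔸) (cellField W M hM ν hν.1 n) F u →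
        ∀ᵐ t ∂(volume.restrict (Ioo 0 T)),
          ∫ x, ‖u t x‖ ^ 2 ≤ CK * Real.exp (-(2 * cK * ν * t)) * ∫ x, ‖F x‖ ^ 2

/-- All classes (admissibility predicate of the W7 re-cut). [cite: BedrossianCotiZelati2017, Thm 1.1 — bookkeeping predicate of this route's W7 clause, text p5 g9] -/
def admAll : ℕ → ℝ → (Fin 3 → ℤ) → Prop := fun _ _ _ => True
/-- Near classes: label ratio `r = dist/(nν) ≤ R₁` (admissibility predicate of the W7 re-cut). [cite: BedrossianCotiZelati2017, Thm 1.1 — bookkeeping predicate of this route's W7 clause, text p5 g9] -/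
def admCompact (R₁ : ℝ) : ℕ → ℝ → (Fin 3 → ℤ) → Prop :=
  fun n ν ℓ => ∃ z : Fin 3 → ℤ, ‖Torus.latticeVec (ℓ + (n : ℤ) • z)‖ ≤ R₁ * n * ν
/-- Far classes: `r ≥ R₁` (admissibility predicate of the W7 re-cut; the regime `ν/|k| ≤ κ₀` of the cited theorem). [cite: BedrossianCotiZelati2017, Thm 1.1 — bookkeeping predicate of this route's W7 clause, text p5 g9] -/
def admLarge (R₁ : ℝ) : ℕ → ℝ → (Fin 3 → ℤ) → Prop :=
  fun n ν ℓ => ∀ z : Fin 3 → ℤ, R₁ * n * ν ≤ ‖Torus.latticeVec (ℓ + (n : ℤ) • z)‖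

/-- Pointwise weakening of the decay profile: larger prefactor, smaller rate. -/
theorem profile_mono {CK CK' cK cK' ν t X : ℝ} (hCK : CK ≤ CK') (hcK : cK' ≤ cK) (hCK0 : 0 ≤ CK') (hν : 0 ≤ ν) (ht : 0 ≤ t)
    (hX : 0 ≤ X) : CK * Real.exp (-(2 * cK * ν * t)) * X ≤ CK' * Real.exp (-(2 * cK' * ν * t)) * X := by
  have h1 : Real.exp (-(2 * cK * ν * t)) ≤ Real.exp (-(2 * cK' * ν * t)) := by
    apply Real.exp_le_exp.mpr
    have : cK' * (ν * t) ≤ cK * (ν * t) := mul_le_mul_of_nonneg_right hcK (mul_nonneg hν ht)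
    nlinarith
  have h2 : CK * Real.exp (-(2 * cK * ν * t)) ≤ CK' * Real.exp (-(2 * cK' * ν * t)) :=
    calc CK * Real.exp (-(2 * cK * ν * t)) ≤ CK' * Real.exp (-(2 * cK * ν * t)) :=
          mul_le_mul_of_nonneg_right hCK (Real.exp_pos _).le
      _ ≤ CK' * Real.exp (-(2 * cK' * ν * t)) := mul_le_mul_of_nonneg_left h1 hCK0
  exact mul_le_mul_of_nonneg_right h2 hX

/-- Monotonicity of `ClassDecayW` in `(CK, cK, ν₀)` and in the admissibility predicate. -/
theorem classDecayW_mono {k : ℕ} {W : LatticeShear.LatticeWord k} {M : ℝ} {hM : 0 < M} {lo hi Λ β ν₀ ν₀' Kb CK CK' cK cK' : ℝ}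
    {adm adm' : ℕ → ℝ → (Fin 3 → ℤ) → Prop} (hν₀ : ν₀' ≤ ν₀) (hCK : CK ≤ CK') (hcK : cK' ≤ cK) (hCK0 : 0 ≤ CK')
    (hadm : ∀ n ν ℓ, adm' n ν ℓ → adm n ν ℓ) (h : ClassDecayW W M hM lo hi Λ β ν₀ Kb CK cK adm) :
    ClassDecayW W M hM lo hi Λ β ν₀' Kb CK' cK' adm' := by
  intro ν hν n hn 𝔸 hodd hwin L hL hKL ℓ hdist hadm' F hF hsupp T hT u hu
  have hν' : ν ∈ Set.Ioo 0 ν₀ := ⟨hν.1, lt_of_lt_of_le hν.2 hν₀⟩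
  have hX : 0 ≤ ∫ x, ‖F x‖ ^ 2 := integral_nonneg fun x => by positivity
  filter_upwards [h ν hν' n hn 𝔸 hodd hwin L hL hKL ℓ hdist (hadm n ν ℓ hadm') F hF hsupp T hT u hu,
    ae_restrict_mem measurableSet_Ioo] with t ht htI
  exact ht.trans (profile_mono hCK hcK hCK0 hν.1.le htI.1.le hX)

/-- SPLICE: near classes + far classes (same `R₁`) give all classes, with constants `max CK`, `min cK`, `min ν₀`. -/
theorem classDecayW_split {k : ℕ} {W : LatticeShear.LatticeWord k} {M : ℝ} {hM : 0 < M} {lo hi Λ β ν₁ ν₂ Kb CK₁ CK₂ cK₁ cK₂ : ℝ}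
    (R₁ : ℝ) (hCK₁ : 0 ≤ CK₁)
    (h₁ : ClassDecayW W M hM lo hi Λ β ν₁ Kb CK₁ cK₁ (admCompact R₁))
    (h₂ : ClassDecayW W M hM lo hi Λ β ν₂ Kb CK₂ cK₂ (admLarge R₁)) :
    ClassDecayW W M hM lo hi Λ β (min ν₁ ν₂) Kb (max CK₁ CK₂) (min cK₁ cK₂) admAll := by
  intro ν hν n hn 𝔸 hodd hwin L hL hKL ℓ hdist _ F hF hsupp T hT u hu
  have hCK0 : 0 ≤ max CK₁ CK₂ := le_max_of_le_left hCK₁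
  by_cases hc : ∃ z : Fin 3 → ℤ, ‖Torus.latticeVec (ℓ + (n : ℤ) • z)‖ ≤ R₁ * n * ν
  · have h₁' := classDecayW_mono (adm' := admCompact R₁) (min_le_left ν₁ ν₂) (le_max_left CK₁ CK₂) (min_le_left cK₁ cK₂) hCK0
      (fun _ _ _ h => h) h₁
    exact h₁' ν hν n hn 𝔸 hodd hwin L hL hKL ℓ hdist hc F hF hsupp T hT u hu
  · have hfar : admLarge R₁ n ν ℓ := by
      intro z
      by_contra hz
      exact hc ⟨z, (not_le.mp hz).le⟩
    have h₂' := classDecayW_mono (adm' := admLarge R₁) (min_le_right ν₁ ν₂) (le_max_right CK₁ CK₂) (min_le_right cK₁ cK₂) hCK0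
      (fun _ _ _ h => h) h₂
    exact h₂' ν hν n hn 𝔸 hodd hwin L hL hKL ℓ hdist hfar F hF hsupp T hT u hu

end

end Summit.AnomalousDissipation.AnomalousDissipation.Theorems.SolenoidalFractalHomogenisation.LagrangianStep
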